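import Literature.NumberTheory.Sieve.RosserSieveBetaOneInduction
import Literature.NumberTheory.Sieve.RosserSieveBetaOneMajorants
import Literature.NumberTheory.Sieve.RosserSieveTheoremOneHalfLt
import Literature.NumberTheory.Sieve.SieveFunctionsBridge
import HarnessLib

/-!
# Rosser's sieve: Lemma 20 at `κ = 1/2` and the discharge of the main-term facts for all `κ ≥ 1/2`

Topic `Literature/NumberTheory/Sieve`; Iwaniec, *Rosser's sieve*, Acta Arith. 36 (1980), §8 Lemma 20 and §9,
Theorem 1. Assembling `RosserSieveBetaOneMajorants.exists_majorant_package_one` (the functions `H^±` at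
`β = 1`), `RosserSieveBetaOneInduction.discT_trunc_le_one` (Rankin at the truncation level
`exp((log y)^{19/20})`) and `RosserSieveBetaOneInduction.claims_all_one` (the induction, amplitudes
`6N(1 + ε)^{2N}`, loss exponent `3/8`), this file PROVES `BetaSieve.Iwaniec1980_lemma20_of_half`, the body of
the named fact `Iwaniec1980_lemma20` (`RosserSieveSums.lean`) at `κ = 1/2` (where the greatest `β`-sieve data
have `β = 1`, `IsBetaSieveSolution.beta_eq_one`); together with `BetaSieve.Iwaniec1980_lemma20_of_half_lt`
(`κ > 1/2`, `RosserSieveMainTermBound.lean`) this DISCHARGES the named facts of the analytic half of Iwaniec's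
Theorem 1 for every `κ ≥ 1/2`:

* `BetaSieve.Iwaniec1980_lemma20_holds : Iwaniec1980_lemma20`;
* `Iwaniec1980_mainTerm_lower_holds`, `Iwaniec1980_mainTerm_upper_holds` (`RosserSieveMainTerm.lean`);
* `Iwaniec1980_thm1_lower_holds`, `Iwaniec1980_thm1_upper_holds` (Iwaniec's Theorem 1, (1.4)–(1.5), in the
  vendored form of `SieveFunctions.lean`);
* `SieveSequence.Iwaniec1980_lower_holds`, `SieveSequence.Iwaniec1980_upper_holds` — the corrected forms of the
  refuted `SieveSequence.jurkat_richert_lower/upper` (`JurkatRichertRefutation.lean`), now unconditional;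
* `SieveSequence.half_dimensional_sieve_lower_holds`, `…_upper_holds` — the half-dimensional sieve
  (`κ = 1/2`, `β = 1`, Iwaniec's `f_{1/2}, F_{1/2}`) in the notation of `jurkat_richert_lower/upper`,
  unconditional (`SieveFunctionsBridge.half_dimensional_sieve_lower/upper`).

Everything here is PROVED; no new definitions.

## References

* H. Iwaniec, *Rosser's sieve*, Acta Arith. 36 (1980), 171–202: §8 Lemma 20, (8.1), (8.4), (8.8)–(8.9); §9
  (9.1)–(9.2); Theorem 1. [IwaniecActaArith1980]
-/

open Finset Filter Set MeasureTheory intervalIntegral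
open scoped Topology

noncomputable section

namespace Literature.NumberTheory.Sieve

namespace BetaSieve

open BetaSieveForward (sieveKernel sieveKernel_nonneg continuousOn_sieveKernel)

variable {κ : ℝ}

/-! ### Choice of the level `y₀` and the constant `C` at `β = 1` -/

/-- **Choice of `y₀` and `C` for the induction `claims_all_one`**: all the side conditions of the `β = 1` step
theorems are met for `y₀ = e^{x}` with `x` beyond finitely many explicit thresholds and `C` a maximum of
finitely many explicit quantities (`0 < κ ≤ 1/2`). [folklore] -/
theorem exists_level_constants_one {L ε ε₁ R c₀ Ccr yc : ℝ} {Hp Hm : ℝ → ℝ} (hκ : 0 < κ) (hκ2 : κ ≤ 1 / 2)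
    (hL : 0 ≤ L) (hε : ε₁ < ε) (hε0 : 0 < ε) (hR : 0 ≤ R) (hc₀ : 0 ≤ c₀)
    (hHpos : ∀ s, 0 < Hp s ∧ 0 < Hm s) :
    ∃ y₀ C : ℝ, 1 ≤ C ∧ Ccr * (1 + L) ≤ C ∧
      (Real.log 2 + 2 * L) * (1 + L / Real.log 2) / (Real.log 2 ^ κ * Hm 2) ≤ C ∧
      ((κ + 1) * L + 1) * R * c₀ * Real.log 2 ^ (-κ) ≤ C ∧
      (κ + 1) * L * (1 - 1 / (2:ℝ)) ^ (-κ - 3 / 8) * R * c₀ ≤ C ∧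
      yc ≤ y₀ ∧ Real.exp (2 ^ 20) ≤ y₀ ∧
      ε₁ + ((κ + 1) * L + 1) * R * Real.log 2 ^ (-κ - 3 / 8) * Real.log y₀ ^ (κ + 3 / 8 - 19 / 20) ≤ ε ∧
      ε₁ + (κ + 1) * L * (1 - 1 / (2:ℝ)) ^ (-κ - 3 / 8) * R * Real.log y₀ ^ (-((19:ℝ) / 20)) ≤ ε ∧
      L * 2 ^ (κ + 1) * Real.log y₀ ^ ((3:ℝ) / 8 - 1) ≤ Hp 2 / 2 ∧
      L * 2 * c₀ * Real.log y₀ ^ ((3:ℝ) / 8 - 1) ≤ 1 / 2 ∧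
      L * 2 / Real.log y₀ ≤ ε ∧
      (1 + (Real.log y₀ / Real.log 2) ^ κ * (1 + L / Real.log 2)) * ((1 + L / Real.log 2) / Real.log 2 ^ κ) *
        Real.log y₀ ^ κ * Real.log y₀ ^ ((3:ℝ) / 8) / Hp (Real.log y₀ ^ ((1:ℝ) / 20)) ≤ C ∧
      (1 + (Real.log y₀ / Real.log 2) ^ κ * (1 + L / Real.log 2)) * ((1 + L / Real.log 2) / Real.log 2 ^ κ) *
        Real.log y₀ ^ κ * Real.log y₀ ^ ((3:ℝ) / 8) / Hm (Real.log y₀ ^ ((1:ℝ) / 20)) ≤ C := by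
  have hlog2 : 0 < Real.log 2 := Real.log_pos one_lt_two
  set b := (1 - 1 / (2:ℝ)) ^ (-κ - 3 / 8) with hb
  have hb0 : 0 ≤ b := Real.rpow_nonneg (by norm_num) _
  set KA := ((κ + 1) * L + 1) * R * Real.log 2 ^ (-κ - 3 / 8) with hKA
  set KB := (κ + 1) * L * b * R with hKB
  set K₃ := L * 2 ^ (κ + 1) with hK₃
  set K₄ := L * 2 * c₀ with hK₄
  have hκ1 : 0 ≤ κ + 1 := by linarith
  have hKA0 : 0 ≤ KA := mul_nonneg (mul_nonneg (by positivity) hR) (Real.rpow_nonneg hlog2.le _)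
  have hKB0 : 0 ≤ KB := mul_nonneg (mul_nonneg (mul_nonneg hκ1 hL) hb0) hR
  have hK₃0 : 0 ≤ K₃ := mul_nonneg hL (Real.rpow_nonneg (by norm_num) _)
  have hK₄0 : 0 ≤ K₄ := mul_nonneg (mul_nonneg hL (by norm_num)) hc₀
  have hHβ := (hHpos 2).1
  set γA : ℝ := 19 / 20 - κ - 3 / 8 with hγA
  have hγA0 : 0 < γA := by rw [hγA]; linarith
  -- the threshold `x` for `log y₀`
  set x : ℝ := max (max (max (2 ^ 20) (Real.log yc)) (max (L * 2 / ε) 1))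
    (max (max (max 1 ((KA / (ε - ε₁)) ^ (1 / γA))) (max 1 ((KB / (ε - ε₁)) ^ (1 / ((19:ℝ) / 20)))))
      (max (max 1 ((K₃ / (Hp 2 / 2)) ^ (1 / ((5:ℝ) / 8)))) (max 1 ((K₄ / (1 / 2)) ^ (1 / ((5:ℝ) / 8)))))) with hx
  have hx20 : (2:ℝ) ^ 20 ≤ x := le_trans (le_trans (le_max_left _ _) (le_max_left _ _)) (le_max_left _ _)
  have hxyc : Real.log yc ≤ x := le_trans (le_trans (le_max_right _ _) (le_max_left _ _)) (le_max_left _ _)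
  have hxε : L * 2 / ε ≤ x := le_trans (le_trans (le_max_left _ _) (le_max_right _ _)) (le_max_left _ _)
  have hx1 : max 1 ((KA / (ε - ε₁)) ^ (1 / γA)) ≤ x :=
    le_trans (le_trans (le_max_left _ _) (le_max_left _ _)) (le_max_right _ _)
  have hx2 : max 1 ((KB / (ε - ε₁)) ^ (1 / ((19:ℝ) / 20))) ≤ x :=
    le_trans (le_trans (le_max_right _ _) (le_max_left _ _)) (le_max_right _ _)
  have hx3 : max 1 ((K₃ / (Hp 2 / 2)) ^ (1 / ((5:ℝ) / 8))) ≤ x :=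
    le_trans (le_trans (le_max_left _ _) (le_max_right _ _)) (le_max_right _ _)
  have hx4' : max 1 ((K₄ / (1 / 2)) ^ (1 / ((5:ℝ) / 8))) ≤ x :=
    le_trans (le_trans (le_max_right _ _) (le_max_right _ _)) (le_max_right _ _)
  have h220 : (1:ℝ) ≤ 2 ^ 20 := by norm_num
  have hx0 : 0 < x := by linarith
  set y₀ := Real.exp x with hy₀
  have hly₀ : Real.log y₀ = x := Real.log_exp x
  -- the constant
  set A := 1 + L / Real.log 2 with hA
  set Csm : ℝ := (1 + (x / Real.log 2) ^ κ * A) * (A / Real.log 2 ^ κ) * x ^ κ * x ^ ((3:ℝ) / 8) with hCsm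
  set K3c := (Real.log 2 + 2 * L) * (1 + L / Real.log 2) / (Real.log 2 ^ κ * Hm 2) with hK3c
  set K4c := ((κ + 1) * L + 1) * R * c₀ * Real.log 2 ^ (-κ) with hK4c
  set K5c := (κ + 1) * L * b * R * c₀ with hK5c
  set C := max (max 1 (Ccr * (1 + L))) (max (max K3c (max K4c K5c))
    (max (Csm / Hp (x ^ ((1:ℝ) / 20))) (Csm / Hm (x ^ ((1:ℝ) / 20))))) with hC
  refine ⟨y₀, C, (le_max_left _ _).trans (le_max_left _ _), (le_max_right _ _).trans (le_max_left _ _),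
    ?_, ?_, ?_, ?_, ?_, ?_, ?_, ?_, ?_, ?_, ?_, ?_⟩
  · exact ((le_max_left _ _).trans (le_max_left _ _)).trans (le_max_right _ _)
  · exact (((le_max_left _ _).trans (le_max_right _ _)).trans (le_max_left _ _)).trans (le_max_right _ _)
  · exact (((le_max_right _ _).trans (le_max_right _ _)).trans (le_max_left _ _)).trans (le_max_right _ _)
  · -- `yc ≤ y₀`
    rcases le_or_gt yc 0 with h | h
    · exact h.trans (Real.exp_pos _).le
    · calc yc = Real.exp (Real.log yc) := (Real.exp_log h).symm
        _ ≤ Real.exp x := Real.exp_le_exp.mpr hxyc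
  · exact Real.exp_le_exp.mpr hx20
  · rw [hly₀, show κ + 3 / 8 - 19 / 20 = -γA by rw [hγA]; ring]
    have := mul_rpow_neg_le_of_ge hKA0 hγA0 (by linarith : 0 < ε - ε₁) hx1
    linarith
  · rw [hly₀]
    have := mul_rpow_neg_le_of_ge hKB0 (by norm_num : (0:ℝ) < 19 / 20) (by linarith : 0 < ε - ε₁) hx2
    linarith
  · rw [hly₀, show ((3:ℝ) / 8 - 1) = -((5:ℝ) / 8) by norm_num]
    exact mul_rpow_neg_le_of_ge hK₃0 (by norm_num) (by linarith) hx3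
  · rw [hly₀, show ((3:ℝ) / 8 - 1) = -((5:ℝ) / 8) by norm_num]
    exact mul_rpow_neg_le_of_ge hK₄0 (by norm_num) (by norm_num) hx4'
  · rw [hly₀, div_le_iff₀ hx0]
    rw [div_le_iff₀ hε0] at hxε
    linarith
  · rw [hly₀]
    exact ((le_max_left _ _).trans (le_max_right _ _)).trans (le_max_right _ _)
  · rw [hly₀]
    exact ((le_max_right _ _).trans (le_max_right _ _)).trans (le_max_right _ _)

/-! ### Lemma 20 at `κ = 1/2` -/

set_option maxHeartbeats 800000 in
/-- **Iwaniec's Lemma 20 (in the vendored form `Iwaniec1980_lemma20`) for `κ = 1/2`.** For the greatest `β`-sieve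
data `(F, f, β, A)` of dimension `1/2` (`β = 1`) and every `L` there is `C` such that for every multiplicative `g`
with `Ω(1/2, L)`, all `2 ≤ z ≤ y` with `s^{50} ≤ log z` (`s = log y/log z`) and all `N`:
`∑_{n ≤ N} T⁺_n(y, P(z)) ≤ V(P(z)) s^{−1/2} (T⁺_N(s) + C (log y)^{−1/3})` whenever `z^{β−1} < y`, and
`∑_{n ≤ N} T⁻_n(y, P(z)) ≤ V(P(z)) s^{−1/2} (T⁻_N(s) + C (log y)^{−1/3})` whenever `z^β < y`.
Proof: for `log y ≥ 1` the hypotheses give `(log y)^{19/20} ≤ log z`, the range of `claims_all_one`, which is run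
with the package `exists_majorant_package_one` (loss exponent `3/8`), amplitudes `6N(1 + ε)^{2N}`,
`ε ≤ 1/336 = 1/(96(5κ + 1))`; `N` is truncated at `N₁ = ⌊(7/2) log log y⌋ + 1` (`discT_le_discT_add_tail`), where
`6N₁(1 + ε)^{2N₁} ≤ K (log y)^{1/24}` is absorbed by `3/8 = 1/3 + 1/24`; small `y` are handled by
`∑_n T_n ≤ V^{−1}`. [cite: IwaniecActaArith1980, Lemma 20 and (9.1)] -/
theorem Iwaniec1980_lemma20_of_half (B : (ℝ → ℝ) × (ℝ → ℝ) × ℝ × ℝ)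
    (hB : IsGreatestBetaSieveData (1 / 2) B) (L : ℝ) :
    ∃ C : ℝ, ∀ g : ArithmeticFunction ℝ, g.IsMultiplicative → HasIwaniecDimension g (1 / 2) L →
      ∀ y z : ℝ, 2 ≤ z → z ≤ y → (Real.log y / Real.log z) ^ 50 ≤ Real.log z → ∀ N : ℕ,
        (z ^ (B.2.2.1 - 1) < y →
          discT 1 g B.2.2.1 y (primesProdBelow z) N ≤
            vprod g (primesProdBelow z) * (Real.log y / Real.log z) ^ (-(1 / 2 : ℝ)) *
              (contT 1 (1 / 2) B.2.2.1 N (Real.log y / Real.log z) + C * Real.log y ^ (-(1 / 3 : ℝ)))) ∧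
        (z ^ B.2.2.1 < y →
          discT 0 g B.2.2.1 y (primesProdBelow z) N ≤
            vprod g (primesProdBelow z) * (Real.log y / Real.log z) ^ (-(1 / 2 : ℝ)) *
              (contT 0 (1 / 2) B.2.2.1 N (Real.log y / Real.log z) + C * Real.log y ^ (-(1 / 3 : ℝ)))) := by
  by_cases hL : 0 ≤ L
  swap
  · exact ⟨0, fun g _ hdim => absurd hdim.nonneg hL⟩
  obtain ⟨F, f, β, A⟩ := B
  have hβ : β = 1 := hB.1.beta_eq_one
  subst hβ
  dsimp only
  have hκ0 : (0:ℝ) < 1 / 2 := by norm_num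
  have hκ2 : (1 / 2 : ℝ) ≤ 1 / 2 := le_rfl
  have hlog2 : 0 < Real.log 2 := Real.log_pos one_lt_two
  -- parameters (`c₂ = 5κ + 1 = 7/2`, `ε ≤ 1/(96 c₂) = 1/336`)
  set ε : ℝ := min (1 / 2) (1 / 336) with hεdef
  have hε0 : 0 < ε := lt_min (by norm_num) (by norm_num)
  have hε1 : ε ≤ 1 / 2 := min_le_left _ _
  have hε2 : ε ≤ 1 / 336 := min_le_right _ _
  -- the package (loss exponent `3/8`), the crude bound, the constants
  obtain ⟨Hp, Hm, R₀, c₀', hHpos, hHp_anti, hHm_anti, hHp_cont, hHm_cont, hH1, hH2, hH3p, hH3m, hH4, hH6⟩ :=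
    exists_majorant_package_one (half_pos hε0)
  set R := max R₀ 0 with hRdef
  set c₀ := max c₀' 0 with hc₀def
  have hR : 0 ≤ R := le_max_right _ _
  have hc₀ : 0 ≤ c₀ := le_max_right _ _
  have hH3p' : ∀ s, 1 ≤ s → Hp (s - 1) ≤ R * Hm s := fun s hs =>
    (hH3p s hs).trans (mul_le_mul_of_nonneg_right (le_max_left _ _) (hHpos s).2.le)
  have hH3m' : ∀ s, 2 ≤ s → Hm (s - 1) ≤ R * Hp s := fun s hs =>
    (hH3m s hs).trans (mul_le_mul_of_nonneg_right (le_max_left _ _) (hHpos s).1.le)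
  have hH4' : ∀ (N : ℕ) (u : ℝ), (1 ≤ u → contT 0 (1 / 2) 1 N u ≤ c₀ * Hm u) ∧
      (0 ≤ u → contT 1 (1 / 2) 1 N u ≤ c₀ * Hp u) :=
    fun N u => ⟨fun hu => ((hH4 N u).1 hu).trans (mul_le_mul_of_nonneg_right (le_max_left _ _) (hHpos u).2.le),
      fun hu => ((hH4 N u).2 hu).trans (mul_le_mul_of_nonneg_right (le_max_left _ _) (hHpos u).1.le)⟩
  obtain ⟨Ccr, yc, hCcr, -, hcrude⟩ := discT_trunc_le_one (L := L) hL
  obtain ⟨y₀, C, hC1, hC2, hC3, hC4, hC5, hy₀c, hy₀, hεc, hεh, hy₀6, hy₀7, hε4, hCp, hCm⟩ :=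
    exists_level_constants_one (κ := 1 / 2) (Ccr := Ccr) (yc := yc) (Hp := Hp) (Hm := Hm) hκ0 hκ2 hL
      (by linarith : ε / 2 < ε) hε0 hR hc₀ hHpos
  have hC0 : 0 ≤ C := le_trans zero_le_one hC1
  -- the final constant
  set Hmax := max (Hp 0) (Hm 0) with hHmax
  have hHmax0 : 0 < Hmax := lt_max_of_lt_left (hHpos 0).1
  set K₅ : ℝ := 6 * ((7 / 2 : ℝ) * 48 + 1) * Real.exp 1 with hK₅
  set Y₁ := max y₀ (Real.exp (Real.exp 4)) with hY₁
  have hY₁1 : 1 < Y₁ := lt_of_lt_of_le (by linarith [Real.add_one_le_exp (Real.exp 4), Real.exp_pos 4]) (le_max_right _ _)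
  have hlY₁ : 0 < Real.log Y₁ := Real.log_pos hY₁1
  set Msm := (Real.log Y₁ / Real.log 2) ^ (1 / 2 : ℝ) * (1 + L / Real.log 2) with hMsm
  set Csm := Msm ^ 2 * (Real.log Y₁ ^ (1 / 50 : ℝ)) ^ (1 / 2 : ℝ) * Real.log Y₁ ^ (1 / 3 : ℝ) with hCsm
  set Atail := (1 / Real.log 2) ^ (1 / 2 : ℝ) * (1 + L / Real.log 2) with hAtail
  set C' := max Csm (2 * K₅ * C * Hmax + 3 * Atail ^ 4) with hC'
  have hAfrac : 0 < 1 / Real.log 2 := by positivity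
  have hAtail0 : 0 < Atail := mul_pos (Real.rpow_pos_of_pos hAfrac _) (by positivity)
  have hCsm0 : 0 ≤ Csm :=
    mul_nonneg (mul_nonneg (sq_nonneg _) (Real.rpow_nonneg (Real.rpow_nonneg hlY₁.le _) _)) (Real.rpow_nonneg hlY₁.le _)
  have hK₅0 : 0 ≤ K₅ := by rw [hK₅]; positivity
  have hC'0 : 0 ≤ C' := hCsm0.trans (le_max_left _ _)
  refine ⟨C', fun g hg hdim y z hz hzy50 hs50 N => ?_⟩
  have hclaims := fun N => claims_all_one (κ := 1 / 2) hκ0 hκ2 hL (half_pos hε0).le hR hc₀ hHpos hHp_anti hHm_anti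
    hHp_cont hHm_cont hH1 hH2 hH3p' hH3m' hH4' hH6 hg hdim hCcr (hcrude g hg hdim) hC1 hC2 hC3 hC4 hC5 hy₀c hy₀
    hεc hεh hε0.le hε1 hy₀6 hy₀7 hε4 hCp hCm N
  clear hH1 hH2 hH3p hH3m hH4 hH6 hH3p' hH3m' hH4' hcrude hεc hεh hy₀6 hy₀7 hε4 hCp hCm hC2 hC3 hC4 hC5 hy₀c
  have hz1 : 1 < z := by linarith
  have hz0 : 0 < z := by linarith
  have hlogz : 0 < Real.log z := Real.log_pos hz1
  have hy1 : 1 < y := by linarith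
  have hy0 : 0 < y := by linarith
  set ly := Real.log y with hly
  have hly0 : 0 < ly := Real.log_pos hy1
  have hlogzy : Real.log z ≤ ly := Real.log_le_log hz0 hzy50
  set s := ly / Real.log z with hsdef
  have hs0 : 0 < s := div_pos hly0 hlogz
  have hs1 : 1 ≤ s := by rw [hsdef, le_div_iff₀ hlogz, one_mul]; exact hlogzy
  set V := vprod g (primesProdBelow z) with hVdef
  have hV : 0 < V := hdim.vprod_pos z
  clear_value V
  have hL2 : 0 ≤ 1 + L / Real.log 2 := by positivity
  have h01 : ∀ p ∈ (primesProdBelow z).primeFactors, 0 ≤ g p ∧ g p < 1 := fun p hp =>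
    hdim.1 p (Nat.prime_of_mem_primeFactors hp)
  -- small levels `y < Y₁`
  have hsmall : ∀ par : ℕ, y < Y₁ →
      discT par g 1 y (primesProdBelow z) N ≤ V * s ^ (-(1 / 2 : ℝ)) * (contT par (1 / 2) 1 N s + C' * ly ^ (-(1 / 3 : ℝ))) := by
    intro par hyY
    have hlyY : ly < Real.log Y₁ := Real.log_lt_log hy0 hyY
    have hVinv : V⁻¹ ≤ Msm := by
      rw [hVdef]
      refine (hdim.inv_vprod_le hz).trans ?_
      exact mul_le_mul_of_nonneg_right (Real.rpow_le_rpow (div_nonneg hlogz.le hlog2.le)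
        (div_le_div_of_nonneg_right (hlogzy.trans hlyY.le) hlog2.le) hκ0.le) hL2
    have hMsm0 : 0 < Msm := lt_of_lt_of_le (inv_pos.mpr hV) hVinv
    have hVge : Msm⁻¹ ≤ V := by rwa [inv_le_comm₀ hMsm0 hV]
    have hD : discT par g 1 y (primesProdBelow z) N ≤ Msm ^ 2 * V := by
      calc discT par g 1 y (primesProdBelow z) N ≤ V⁻¹ := by
            rw [hVdef]; exact discT_le_inv_vprod hg (squarefree_primesProdBelow z) h01 par 1 y N
        _ ≤ Msm := hVinv
        _ = Msm ^ 2 * Msm⁻¹ := by field_simp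
        _ ≤ Msm ^ 2 * V := mul_le_mul_of_nonneg_left hVge (sq_nonneg _)
    have hs50' : s ≤ Real.log Y₁ ^ (1 / 50 : ℝ) := by
      have h1 : s ^ (50 : ℕ) ≤ Real.log Y₁ := hs50.trans (hlogzy.trans hlyY.le)
      have h2 : s = (s ^ (50 : ℕ)) ^ (1 / 50 : ℝ) := by
        rw [← Real.rpow_natCast, ← Real.rpow_mul hs0.le]; norm_num
      rw [h2]
      exact Real.rpow_le_rpow (pow_nonneg hs0.le _) h1 (by norm_num)
    have h1 : (Real.log Y₁ ^ (1 / 50 : ℝ)) ^ (-(1 / 2 : ℝ)) ≤ s ^ (-(1 / 2 : ℝ)) :=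
      Real.rpow_le_rpow_of_nonpos hs0 hs50' (by norm_num)
    have h3 : Real.log Y₁ ^ (-(1 / 3 : ℝ)) ≤ ly ^ (-(1 / 3 : ℝ)) :=
      Real.rpow_le_rpow_of_nonpos hly0 hlyY.le (by norm_num)
    have hcT0 : 0 ≤ contT par (1 / 2) 1 N s := contT_nonneg hκ0.le le_rfl par N hs0.le
    have hsm0 : 0 < Real.log Y₁ ^ (1 / 50 : ℝ) := Real.rpow_pos_of_pos hlY₁ _
    have hkey : Msm ^ 2 ≤ (Real.log Y₁ ^ (1 / 50 : ℝ)) ^ (-(1 / 2 : ℝ)) * (Csm * Real.log Y₁ ^ (-(1 / 3 : ℝ))) := by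
      rw [hCsm, Real.rpow_neg hsm0.le, Real.rpow_neg hlY₁.le]
      have ha : 0 < (Real.log Y₁ ^ (1 / 50 : ℝ)) ^ (1 / 2 : ℝ) := Real.rpow_pos_of_pos hsm0 _
      have hb : 0 < Real.log Y₁ ^ (1 / 3 : ℝ) := Real.rpow_pos_of_pos hlY₁ _
      rw [show ((Real.log Y₁ ^ (1 / 50 : ℝ)) ^ (1 / 2 : ℝ))⁻¹ *
          (Msm ^ 2 * (Real.log Y₁ ^ (1 / 50 : ℝ)) ^ (1 / 2 : ℝ) * Real.log Y₁ ^ (1 / 3 : ℝ) * (Real.log Y₁ ^ (1 / 3 : ℝ))⁻¹) =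
          Msm ^ 2 by field_simp]
    have hCsmC' : Csm ≤ C' := le_max_left _ _
    calc discT par g 1 y (primesProdBelow z) N ≤ Msm ^ 2 * V := hD
      _ ≤ (Real.log Y₁ ^ (1 / 50 : ℝ)) ^ (-(1 / 2 : ℝ)) * (Csm * Real.log Y₁ ^ (-(1 / 3 : ℝ))) * V :=
          mul_le_mul_of_nonneg_right hkey hV.le
      _ ≤ s ^ (-(1 / 2 : ℝ)) * (C' * ly ^ (-(1 / 3 : ℝ))) * V := by
          refine mul_le_mul_of_nonneg_right (mul_le_mul h1 (mul_le_mul hCsmC' h3 (Real.rpow_nonneg hlY₁.le _) hC'0)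
            (mul_nonneg hCsm0 (Real.rpow_nonneg hlY₁.le _)) (Real.rpow_nonneg hs0.le _)) hV.le
      _ = V * s ^ (-(1 / 2 : ℝ)) * (C' * ly ^ (-(1 / 3 : ℝ))) := by ring
      _ ≤ V * s ^ (-(1 / 2 : ℝ)) * (contT par (1 / 2) 1 N s + C' * ly ^ (-(1 / 3 : ℝ))) :=
          mul_le_mul_of_nonneg_left (by linarith) (mul_nonneg hV.le (Real.rpow_nonneg hs0.le _))
  -- large levels `y ≥ Y₁`: `ly^{19/20} ≤ log z`
  have hmain : ∀ (par : ℕ) (H : ℝ → ℝ), (∀ s, 0 < H s) → Antitone H → H 0 ≤ Hmax → Y₁ ≤ y →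
      (∀ N : ℕ, Real.log y ^ ((19:ℝ) / 20) ≤ Real.log z → discT par g 1 y (primesProdBelow z) N ≤
        V * s ^ (-(1 / 2 : ℝ)) * (contT par (1 / 2) 1 N s + (6 * (N : ℝ) * (1 + ε) ^ (2 * N)) * C * H s * ly ^ (-(3 / 8 : ℝ)))) →
      discT par g 1 y (primesProdBelow z) N ≤ V * s ^ (-(1 / 2 : ℝ)) * (contT par (1 / 2) 1 N s + C' * ly ^ (-(1 / 3 : ℝ))) := by
    intro par H hH hHanti hH0 hyY hbound
    have hy4 : Real.exp (Real.exp 4) ≤ y := (le_max_right _ _).trans hyY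
    have hlye : Real.exp 4 ≤ ly := by rw [hly, Real.le_log_iff_exp_le hy0]; exact hy4
    have hly4 : 4 < ly := lt_of_lt_of_le (by linarith [Real.add_one_le_exp (4:ℝ)]) hlye
    have hly1 : 1 ≤ ly := by linarith
    have hlly : 4 ≤ Real.log ly := by rw [Real.le_log_iff_exp_le hly0]; exact hlye
    -- `ly^{19/20} ≤ log z` and `s ≤ √ly` from `s^50 ≤ log z ≤ ly`: `log z ≥ ly^{50/51}`
    have h2 : ly ^ (50 / 51 : ℝ) ≤ Real.log z := by
      have h1 : ly ^ (50 : ℕ) ≤ Real.log z ^ (51 : ℕ) := by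
        have h := mul_le_mul_of_nonneg_right hs50 (pow_nonneg hlogz.le 50)
        rw [hsdef, div_pow, div_mul_cancel₀ _ (pow_ne_zero _ hlogz.ne')] at h
        calc ly ^ 50 ≤ Real.log z * Real.log z ^ 50 := h
          _ = Real.log z ^ 51 := by ring
      have h := Real.rpow_le_rpow (pow_nonneg hly0.le _) h1 (by norm_num : (0:ℝ) ≤ 1 / 51)
      rw [← Real.rpow_natCast ly 50, ← Real.rpow_natCast (Real.log z) 51, ← Real.rpow_mul hly0.le,
        ← Real.rpow_mul hlogz.le] at h
      norm_num at h
      exact h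
    have hsz19 : Real.log y ^ ((19:ℝ) / 20) ≤ Real.log z := by
      rw [← hly]
      calc ly ^ ((19:ℝ) / 20) ≤ ly ^ (50 / 51 : ℝ) := Real.rpow_le_rpow_of_exponent_le hly1 (by norm_num)
        _ ≤ Real.log z := h2
    have hsz : Real.sqrt ly ≤ Real.log z := by
      calc Real.sqrt ly = ly ^ (1 / 2 : ℝ) := Real.sqrt_eq_rpow ly
        _ ≤ ly ^ (50 / 51 : ℝ) := Real.rpow_le_rpow_of_exponent_le hly1 (by norm_num)
        _ ≤ Real.log z := h2
    have hss : s ≤ Real.sqrt ly := by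
      rw [hsdef, div_le_iff₀ hlogz]
      calc ly = Real.sqrt ly * Real.sqrt ly := (Real.mul_self_sqrt hly0.le).symm
        _ ≤ Real.sqrt ly * Real.log z := mul_le_mul_of_nonneg_left hsz (Real.sqrt_nonneg _)
    -- truncation index
    obtain ⟨N₁, hN₁le, hN₁ge⟩ : ∃ N₁ : ℕ, (N₁ : ℝ) ≤ 7 / 2 * Real.log ly + 1 ∧ 7 / 2 * Real.log ly < N₁ := by
      refine ⟨⌊7 / 2 * Real.log ly⌋₊ + 1, ?_, ?_⟩
      · push_cast
        linarith [Nat.floor_le (show (0:ℝ) ≤ 7 / 2 * Real.log ly by linarith)]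
      · push_cast; exact Nat.lt_floor_add_one _
    -- amplitude at `N₁`
    have hamp : 6 * (N₁ : ℝ) * (1 + ε) ^ (2 * N₁) ≤ K₅ * ly ^ (1 / 24 : ℝ) := by
      have h1 : (1 + ε) ^ (2 * N₁) ≤ Real.exp 1 * ly ^ (1 / 48 : ℝ) := by
        calc (1 + ε) ^ (2 * N₁) ≤ Real.exp (ε * (2 * N₁ : ℕ)) := one_add_pow_le_exp_mul hε0.le _
          _ ≤ Real.exp (1 + (1 / 48) * Real.log ly) := by
              refine Real.exp_le_exp.mpr ?_
              push_cast
              have hεc : ε * (7 / 2) ≤ 1 / 96 := by linarith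
              have h4 : 0 ≤ Real.log ly := by linarith
              have h5 : ε * (7 / 2) * Real.log ly ≤ 1 / 96 * Real.log ly := mul_le_mul_of_nonneg_right hεc h4
              have h6 : ε * (2 * (7 / 2 * Real.log ly + 1)) = 2 * (ε * (7 / 2) * Real.log ly) + 2 * ε := by ring
              have : ε * (2 * (7 / 2 * Real.log ly + 1)) ≤ 1 + 1 / 48 * Real.log ly := by rw [h6]; linarith
              have h' : ε * (2 * (N₁ : ℝ)) ≤ ε * (2 * (7 / 2 * Real.log ly + 1)) :=
                mul_le_mul_of_nonneg_left (by linarith) hε0.le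
              linarith
          _ = Real.exp 1 * ly ^ (1 / 48 : ℝ) := by
              rw [Real.exp_add, Real.rpow_def_of_pos hly0]; ring_nf
      have h2 : 6 * (N₁ : ℝ) ≤ 6 * ((7 / 2 : ℝ) * 48 + 1) * ly ^ (1 / 48 : ℝ) := by
        have hl : Real.log ly ≤ ly ^ (1 / 48 : ℝ) / (1 / 48) := Real.log_le_rpow_div hly0.le (by norm_num)
        have hp1 : 1 ≤ ly ^ (1 / 48 : ℝ) := Real.one_le_rpow hly1 (by norm_num)
        have : Real.log ly ≤ 48 * ly ^ (1 / 48 : ℝ) := by linarith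
        linarith
      have h3 : ly ^ (1 / 48 : ℝ) * ly ^ (1 / 48 : ℝ) = ly ^ (1 / 24 : ℝ) := by
        rw [← Real.rpow_add hly0]; norm_num
      calc 6 * (N₁ : ℝ) * (1 + ε) ^ (2 * N₁) ≤ (6 * ((7 / 2 : ℝ) * 48 + 1) * ly ^ (1 / 48 : ℝ)) * (Real.exp 1 * ly ^ (1 / 48 : ℝ)) :=
            mul_le_mul h2 h1 (pow_nonneg (by linarith) _)
              (mul_nonneg (mul_nonneg (by positivity) (by linarith)) (Real.rpow_nonneg hly0.le _))
        _ = K₅ * ly ^ (1 / 24 : ℝ) := by rw [hK₅, ← h3]; ring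
    have hNN : ∀ N' : ℕ, N' ≤ N₁ → 6 * (N' : ℝ) * (1 + ε) ^ (2 * N') ≤ K₅ * ly ^ (1 / 24 : ℝ) := by
      intro N' hN'
      refine le_trans ?_ hamp
      have h1e : (1:ℝ) ≤ 1 + ε := by linarith
      have hc : (N' : ℝ) ≤ N₁ := Nat.cast_le.mpr hN'
      have hp : (1 + ε) ^ (2 * N') ≤ (1 + ε) ^ (2 * N₁) := pow_le_pow_right₀ h1e (Nat.mul_le_mul_left 2 hN')
      have hN₁0 : (0:ℝ) ≤ N₁ := Nat.cast_nonneg N₁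
      calc 6 * (N' : ℝ) * (1 + ε) ^ (2 * N') ≤ 6 * (N₁ : ℝ) * (1 + ε) ^ (2 * N') :=
            mul_le_mul_of_nonneg_right (by linarith) (pow_nonneg (by linarith) _)
        _ ≤ 6 * (N₁ : ℝ) * (1 + ε) ^ (2 * N₁) := mul_le_mul_of_nonneg_left hp (by linarith)
    have herr : K₅ * ly ^ (1 / 24 : ℝ) * C * H s * ly ^ (-(3 / 8 : ℝ)) ≤ K₅ * C * Hmax * ly ^ (-(1 / 3 : ℝ)) := by
      have hHs : H s ≤ Hmax := (hHanti hs0.le).trans hH0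
      have hsplit : ly ^ (1 / 24 : ℝ) * ly ^ (-(3 / 8 : ℝ)) = ly ^ (-(1 / 3 : ℝ)) := by
        rw [← Real.rpow_add hly0]; norm_num
      calc K₅ * ly ^ (1 / 24 : ℝ) * C * H s * ly ^ (-(3 / 8 : ℝ))
          = K₅ * C * H s * (ly ^ (1 / 24 : ℝ) * ly ^ (-(3 / 8 : ℝ))) := by ring
        _ ≤ K₅ * C * Hmax * (ly ^ (1 / 24 : ℝ) * ly ^ (-(3 / 8 : ℝ))) := by
            refine mul_le_mul_of_nonneg_right (mul_le_mul_of_nonneg_left hHs (mul_nonneg hK₅0 hC0)) ?_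
            rw [hsplit]; exact Real.rpow_nonneg hly0.le _
        _ = K₅ * C * Hmax * ly ^ (-(1 / 3 : ℝ)) := by rw [hsplit]
    -- the tail
    have htail : V ^ (-(3 : ℝ)) * (1 / 3 : ℝ) ^ N₁ / 2 ≤ V * s ^ (-(1 / 2 : ℝ)) * (3 * Atail ^ 4 * ly ^ (-(1 / 3 : ℝ))) := by
      have hVinv : V⁻¹ ≤ Atail * ly ^ (1 / 2 : ℝ) := by
        rw [hVdef]
        refine (hdim.inv_vprod_le hz).trans ?_
        have h1 : Real.log z / Real.log 2 ≤ ly * (1 / Real.log 2) := by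
          rw [mul_one_div]; exact div_le_div_of_nonneg_right hlogzy hlog2.le
        have h2 := Real.rpow_le_rpow (div_nonneg hlogz.le hlog2.le) h1 hκ0.le
        rw [Real.mul_rpow hly0.le hAfrac.le] at h2
        calc (Real.log z / Real.log 2) ^ (1 / 2 : ℝ) * (1 + L / Real.log 2)
            ≤ ly ^ (1 / 2 : ℝ) * (1 / Real.log 2) ^ (1 / 2 : ℝ) * (1 + L / Real.log 2) :=
              mul_le_mul_of_nonneg_right h2 hL2
          _ = Atail * ly ^ (1 / 2 : ℝ) := by rw [hAtail]; ring
      have hgeo : (1 / 3 : ℝ) ^ N₁ ≤ ly ^ (-(7 / 2 : ℝ)) := by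
        have hlog3 : 1 ≤ Real.log 3 := by
          rw [Real.le_log_iff_exp_le (by norm_num)]
          exact Real.exp_one_lt_d9.le.trans (by norm_num)
        have e1 : (1 / 3 : ℝ) ^ N₁ = Real.exp (-(Real.log 3 * N₁)) := by
          rw [← Real.exp_log (by positivity : (0:ℝ) < (1 / 3) ^ N₁), Real.log_pow, Real.log_div one_ne_zero
            three_ne_zero, Real.log_one, zero_sub]
          ring_nf
        rw [e1, Real.rpow_def_of_pos hly0, Real.exp_le_exp]
        have h4 : 0 ≤ Real.log ly := by linarith
        have hN₁0 : (0:ℝ) ≤ N₁ := Nat.cast_nonneg N₁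
        have h5 : 1 * (N₁ : ℝ) ≤ Real.log 3 * N₁ := mul_le_mul_of_nonneg_right hlog3 hN₁0
        have : 7 / 2 * Real.log ly ≤ Real.log 3 * N₁ := by linarith [hN₁ge.le]
        have h6 : Real.log ly * -(7 / 2 : ℝ) = -(7 / 2 * Real.log ly) := by ring
        rw [h6]
        linarith
      have hV3 : V ^ (-(3 : ℝ)) ≤ V * (Atail * ly ^ (1 / 2 : ℝ)) ^ 4 := by
        have hVle : V⁻¹ ^ 4 ≤ (Atail * ly ^ (1 / 2 : ℝ)) ^ 4 := pow_le_pow_left₀ (inv_nonneg.mpr hV.le) hVinv 4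
        have e1 : V ^ (-(3 : ℝ)) = V * V⁻¹ ^ 4 := by
          rw [Real.rpow_neg hV.le, show (3:ℝ) = ((3:ℕ):ℝ) by norm_num, Real.rpow_natCast, ← inv_pow,
            pow_succ V⁻¹ 3, mul_comm V, mul_assoc, inv_mul_cancel₀ hV.ne', mul_one]
        rw [e1]
        exact mul_le_mul_of_nonneg_left hVle hV.le
      have hsκ : s ^ (1 / 2 : ℝ) ≤ ly ^ ((1 / 2 : ℝ) / 2) := by
        calc s ^ (1 / 2 : ℝ) ≤ (Real.sqrt ly) ^ (1 / 2 : ℝ) := Real.rpow_le_rpow hs0.le hss hκ0.le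
          _ = ly ^ ((1 / 2 : ℝ) / 2) := by rw [Real.sqrt_eq_rpow, ← Real.rpow_mul hly0.le]; ring_nf
      have hkey : (Atail * ly ^ (1 / 2 : ℝ)) ^ 4 * ly ^ (-(7 / 2 : ℝ)) ≤ s ^ (-(1 / 2 : ℝ)) * (Atail ^ 4 * ly ^ (-(1 / 3 : ℝ))) := by
        rw [Real.rpow_neg hs0.le]
        have hsκ0 : 0 < s ^ (1 / 2 : ℝ) := Real.rpow_pos_of_pos hs0 _
        rw [show (s ^ (1 / 2 : ℝ))⁻¹ * (Atail ^ 4 * ly ^ (-(1 / 3 : ℝ))) = (Atail ^ 4 * ly ^ (-(1 / 3 : ℝ))) / s ^ (1 / 2 : ℝ) by ring,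
          le_div_iff₀ hsκ0]
        have e1 : (Atail * ly ^ (1 / 2 : ℝ)) ^ 4 * ly ^ (-(7 / 2 : ℝ)) * s ^ (1 / 2 : ℝ) =
            Atail ^ 4 * (ly ^ (4 * (1 / 2 : ℝ) - 7 / 2) * s ^ (1 / 2 : ℝ)) := by
          rw [mul_pow, ← Real.rpow_natCast (ly ^ (1 / 2 : ℝ)) 4, ← Real.rpow_mul hly0.le,
            show (4 * (1 / 2 : ℝ) - 7 / 2) = (1 / 2 : ℝ) * ((4:ℕ):ℝ) + -(7 / 2 : ℝ) by push_cast; ring, Real.rpow_add hly0]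
          ring
        rw [e1]
        refine mul_le_mul_of_nonneg_left ?_ (pow_nonneg hAtail0.le 4)
        calc ly ^ (4 * (1 / 2 : ℝ) - 7 / 2) * s ^ (1 / 2 : ℝ) ≤ ly ^ (4 * (1 / 2 : ℝ) - 7 / 2) * ly ^ ((1 / 2 : ℝ) / 2) :=
              mul_le_mul_of_nonneg_left hsκ (Real.rpow_nonneg hly0.le _)
          _ = ly ^ (4 * (1 / 2 : ℝ) - 7 / 2 + (1 / 2 : ℝ) / 2) := by rw [← Real.rpow_add hly0]
          _ ≤ ly ^ (-(1 / 3 : ℝ)) := Real.rpow_le_rpow_of_exponent_le hly1 (by norm_num)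
      have hpos : 0 ≤ V * (s ^ (-(1 / 2 : ℝ)) * (Atail ^ 4 * ly ^ (-(1 / 3 : ℝ)))) :=
        mul_nonneg hV.le (mul_nonneg (Real.rpow_nonneg hs0.le _)
          (mul_nonneg (pow_nonneg hAtail0.le 4) (Real.rpow_nonneg hly0.le _)))
      have hnum : V ^ (-(3 : ℝ)) * (1 / 3 : ℝ) ^ N₁ ≤ V * (s ^ (-(1 / 2 : ℝ)) * (Atail ^ 4 * ly ^ (-(1 / 3 : ℝ)))) := by
        have h1 : V ^ (-(3 : ℝ)) * (1 / 3 : ℝ) ^ N₁ ≤ V * (Atail * ly ^ (1 / 2 : ℝ)) ^ 4 * ly ^ (-(7 / 2 : ℝ)) :=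
          mul_le_mul hV3 hgeo (pow_nonneg (by norm_num) _)
            (mul_nonneg hV.le (pow_nonneg (mul_nonneg hAtail0.le (Real.rpow_nonneg hly0.le _)) 4))
        have h2 : V * (Atail * ly ^ (1 / 2 : ℝ)) ^ 4 * ly ^ (-(7 / 2 : ℝ)) ≤ V * (s ^ (-(1 / 2 : ℝ)) * (Atail ^ 4 * ly ^ (-(1 / 3 : ℝ)))) := by
          rw [mul_assoc]; exact mul_le_mul_of_nonneg_left hkey hV.le
        exact h1.trans h2
      have e2 : V * s ^ (-(1 / 2 : ℝ)) * (3 * Atail ^ 4 * ly ^ (-(1 / 3 : ℝ))) =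
          3 * (V * (s ^ (-(1 / 2 : ℝ)) * (Atail ^ 4 * ly ^ (-(1 / 3 : ℝ))))) := by ring
      rw [e2]
      have h3 : V ^ (-(3 : ℝ)) * (1 / 3 : ℝ) ^ N₁ / 2 ≤ V * (s ^ (-(1 / 2 : ℝ)) * (Atail ^ 4 * ly ^ (-(1 / 3 : ℝ)))) / 2 :=
        div_le_div_of_nonneg_right hnum zero_le_two
      linarith only [hpos, h3]
    -- combine
    set N' := min N N₁ with hN'
    have hN'le : N' ≤ N₁ := min_le_right _ _
    have hN'N : N' ≤ N := min_le_left _ _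
    have hb := hbound N' hsz19
    have hcontT : contT par (1 / 2) 1 N' s ≤ contT par (1 / 2) 1 N s := contT_mono_right hκ0.le le_rfl par hs0.le hN'N
    have hamp' := hNN N' hN'le
    have h1 : discT par g 1 y (primesProdBelow z) N ≤ discT par g 1 y (primesProdBelow z) N' +
        V ^ (-(3 : ℝ)) * (1 / 3 : ℝ) ^ N₁ / 2 := by
      rcases le_or_gt N N₁ with h | h
      · have hNeq : N' = N := min_eq_left h
        rw [hNeq]
        have : 0 ≤ V ^ (-(3 : ℝ)) * (1 / 3 : ℝ) ^ N₁ / 2 :=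
          div_nonneg (mul_nonneg (Real.rpow_nonneg hV.le _) (by positivity)) (by norm_num)
        linarith
      · have hNeq : N' = N₁ := min_eq_right h.le
        rw [hNeq]
        have := discT_le_discT_add_tail (κ := 1 / 2) (β := 1) hg hdim y z par h.le
        rwa [← hVdef] at this
    have hT0 : 0 ≤ ly ^ (-(3 / 8 : ℝ)) := Real.rpow_nonneg hly0.le _
    have hVs : 0 ≤ V * s ^ (-(1 / 2 : ℝ)) := mul_nonneg hV.le (Real.rpow_nonneg hs0.le _)
    have h2 : V * s ^ (-(1 / 2 : ℝ)) * (contT par (1 / 2) 1 N' s + 6 * (N' : ℝ) * (1 + ε) ^ (2 * N') * C * H s * ly ^ (-(3 / 8 : ℝ))) ≤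
        V * s ^ (-(1 / 2 : ℝ)) * (contT par (1 / 2) 1 N s + K₅ * C * Hmax * ly ^ (-(1 / 3 : ℝ))) := by
      refine mul_le_mul_of_nonneg_left ?_ hVs
      have : 6 * (N' : ℝ) * (1 + ε) ^ (2 * N') * C * H s * ly ^ (-(3 / 8 : ℝ)) ≤
          K₅ * ly ^ (1 / 24 : ℝ) * C * H s * ly ^ (-(3 / 8 : ℝ)) :=
        mul_le_mul_of_nonneg_right (mul_le_mul_of_nonneg_right (mul_le_mul_of_nonneg_right hamp' hC0)
          (hH s).le) hT0
      linarith [herr]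
    have hC'ge : 2 * K₅ * C * Hmax + 3 * Atail ^ 4 ≤ C' := le_max_right _ _
    have hly3 : 0 ≤ ly ^ (-(1 / 3 : ℝ)) := Real.rpow_nonneg hly0.le _
    calc discT par g 1 y (primesProdBelow z) N
        ≤ V * s ^ (-(1 / 2 : ℝ)) * (contT par (1 / 2) 1 N s + K₅ * C * Hmax * ly ^ (-(1 / 3 : ℝ))) +
            V * s ^ (-(1 / 2 : ℝ)) * (3 * Atail ^ 4 * ly ^ (-(1 / 3 : ℝ))) := by linarith [h1, hb.trans h2, htail]
      _ = V * s ^ (-(1 / 2 : ℝ)) * (contT par (1 / 2) 1 N s + (K₅ * C * Hmax + 3 * Atail ^ 4) * ly ^ (-(1 / 3 : ℝ))) := by ring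
      _ ≤ V * s ^ (-(1 / 2 : ℝ)) * (contT par (1 / 2) 1 N s + C' * ly ^ (-(1 / 3 : ℝ))) := by
          refine mul_le_mul_of_nonneg_left ?_ hVs
          have hKC : K₅ * C * Hmax + 3 * Atail ^ 4 ≤ C' := by
            have : 0 ≤ K₅ * C * Hmax := mul_nonneg (mul_nonneg hK₅0 hC0) hHmax0.le
            linarith
          have := mul_le_mul_of_nonneg_right hKC hly3
          linarith
  constructor
  · intro _
    rcases lt_or_ge y Y₁ with hy | hy
    · exact hsmall 1 hy
    · exact hmain 1 Hp (fun s => (hHpos s).1) hHp_anti (le_max_left _ _) hy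
        (fun N hsz => by have h := (hclaims N).2 y z hz hy1 hsz; rwa [← hVdef] at h)
  · intro hzy
    rw [Real.rpow_one] at hzy
    rcases lt_or_ge y Y₁ with hy | hy
    · exact hsmall 0 hy
    · exact hmain 0 Hm (fun s => (hHpos s).2) hHm_anti (le_max_right _ _) hy
        (fun N hsz => by have h := (hclaims N).1 y z hz hzy hsz; rwa [← hVdef] at h)

/-- **Iwaniec's Lemma 20, PROVED for every `κ ≥ 1/2`**: the named fact `Iwaniec1980_lemma20`
(`RosserSieveSums.lean`) holds (`κ > 1/2`: `Iwaniec1980_lemma20_of_half_lt`; `κ = 1/2`: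
`Iwaniec1980_lemma20_of_half`). [cite: IwaniecActaArith1980, Lemma 20 and (9.1)] -/
theorem Iwaniec1980_lemma20_holds : Iwaniec1980_lemma20 := by
  intro κ hκ B hB L
  rcases eq_or_lt_of_le hκ with heq | hlt
  · subst heq
    exact Iwaniec1980_lemma20_of_half B hB L
  · exact Iwaniec1980_lemma20_of_half_lt hlt B hB L

end BetaSieve

/-! ### The main-term facts, Theorem 1 and the corrected sieve theorems, for all `κ ≥ 1/2` -/

/-- **Main term of Rosser's sieve, lower bound, DISCHARGED**: the named fact `Iwaniec1980_mainTerm_lower`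
(`RosserSieveMainTerm.lean`) holds for every `κ ≥ 1/2`. [cite: IwaniecActaArith1980, Thm 1 (proof), §9] -/
theorem Iwaniec1980_mainTerm_lower_holds : Iwaniec1980_mainTerm_lower := by
  intro κ hκ
  obtain ⟨B, hB⟩ := exists_isGreatestBetaSieveData_holds hκ
  exact ⟨B, hB, Iwaniec1980_mainTerm_lower_local hκ B hB (BetaSieve.Iwaniec1980_lemma20_holds hκ B hB)⟩

/-- **Main term of Rosser's sieve, upper bound, DISCHARGED**: the named fact `Iwaniec1980_mainTerm_upper` holds
for every `κ ≥ 1/2`. [cite: IwaniecActaArith1980, Thm 1 (proof), §9] -/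
theorem Iwaniec1980_mainTerm_upper_holds : Iwaniec1980_mainTerm_upper := by
  intro κ hκ
  obtain ⟨B, hB⟩ := exists_isGreatestBetaSieveData_holds hκ
  exact ⟨B, hB, Iwaniec1980_mainTerm_upper_local hκ B hB (BetaSieve.Iwaniec1980_lemma20_holds hκ B hB)⟩

/-- **Iwaniec's Theorem 1, lower bound (1.5), DISCHARGED** for every `κ ≥ 1/2` (the named fact
`Iwaniec1980_thm1_lower` of `SieveFunctions.lean`). [cite: IwaniecActaArith1980, Thm 1 (1.5)–(1.6)] -/
theorem Iwaniec1980_thm1_lower_holds : Iwaniec1980_thm1_lower :=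
  Iwaniec1980_thm1_lower_of_mainTerm Iwaniec1980_mainTerm_lower_holds

/-- **Iwaniec's Theorem 1, upper bound (1.4), DISCHARGED** for every `κ ≥ 1/2` (the named fact
`Iwaniec1980_thm1_upper`). [cite: IwaniecActaArith1980, Thm 1 (1.4), (1.6)] -/
theorem Iwaniec1980_thm1_upper_holds : Iwaniec1980_thm1_upper :=
  Iwaniec1980_thm1_upper_of_mainTerm Iwaniec1980_mainTerm_upper_holds

/-- **The corrected lower-bound sieve theorem, DISCHARGED**: `SieveSequence.Iwaniec1980_lower` — the faithful
form (Iwaniec's greatest-`β` functions `F_κ, f_κ`) of the refuted `SieveSequence.jurkat_richert_lower` — holds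
for every `κ ≥ 1/2`. [cite: IwaniecActaArith1980, Thm 1 (corollary)] -/
theorem SieveSequence.Iwaniec1980_lower_holds : SieveSequence.Iwaniec1980_lower :=
  SieveSequence.Iwaniec1980_lower_of_mainTerm Iwaniec1980_mainTerm_lower_holds

/-- **The corrected upper-bound sieve theorem, DISCHARGED**: `SieveSequence.Iwaniec1980_upper` holds for every
`κ ≥ 1/2`. [cite: IwaniecActaArith1980, Thm 1 (corollary)] -/
theorem SieveSequence.Iwaniec1980_upper_holds : SieveSequence.Iwaniec1980_upper :=
  SieveSequence.Iwaniec1980_upper_of_mainTerm Iwaniec1980_mainTerm_upper_holds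

/-- **The half-dimensional sieve, lower bound, unconditional** (`κ = 1/2`, `β = 1`, Iwaniec's `f_{1/2}` =
`lowerSieveFun (1/2)`): the case `κ = 1/2` of `SieveSequence.jurkat_richert_lower` (whose general form is
refuted), now PROVED via `SieveSequence.Iwaniec1980_lower_holds`. [cite: IwaniecActaArith1980, Thm 1] -/
theorem SieveSequence.half_dimensional_sieve_lower_holds (A : SieveSequence) {L θ : ℝ}
    (hθ : 0 < θ) (hdim : HasIwaniecDimension A.density (1 / 2) L)
    (hlevel : HasLevelOfDistribution A θ) (hsize : ∀ᶠ x : ℝ in atTop, 0 ≤ A.size x) :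
    ∀ ε δ : ℝ, 0 < ε → 0 < δ → ∀ᶠ x : ℝ in atTop, ∀ z : ℝ, 2 ≤ z → z ≤ x ^ (θ - δ) →
      A.size x * A.densityProduct (primesProdBelow z) *
          (lowerSieveFun (1 / 2) (θ * Real.log x / Real.log z) - ε) ≤
        A.sifted x (primesProdBelow z) :=
  SieveSequence.half_dimensional_sieve_lower SieveSequence.Iwaniec1980_lower_holds A hθ hdim hlevel hsize

/-- **The half-dimensional sieve, upper bound, unconditional** (`κ = 1/2`, Iwaniec's `F_{1/2}` =
`upperSieveFun (1/2)`), via `SieveSequence.Iwaniec1980_upper_holds`. [cite: IwaniecActaArith1980, Thm 1] -/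
theorem SieveSequence.half_dimensional_sieve_upper_holds (A : SieveSequence) {L θ : ℝ}
    (hθ : 0 < θ) (hdim : HasIwaniecDimension A.density (1 / 2) L)
    (hlevel : HasLevelOfDistribution A θ) (hsize : ∀ᶠ x : ℝ in atTop, 0 ≤ A.size x) :
    ∀ ε δ : ℝ, 0 < ε → 0 < δ → ∀ᶠ x : ℝ in atTop, ∀ z : ℝ, 2 ≤ z → z ≤ x ^ (θ - δ) →
      A.sifted x (primesProdBelow z) ≤
        A.size x * A.densityProduct (primesProdBelow z) *
          (upperSieveFun (1 / 2) (θ * Real.log x / Real.log z) + ε) :=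
  SieveSequence.half_dimensional_sieve_upper SieveSequence.Iwaniec1980_upper_holds A hθ hdim hlevel hsize

end Literature.NumberTheory.Sieve
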